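import Summits.BirchSwinnertonDyer.BirchSwinnertonDyer.Theorems.GenusKolyvaginAtTwoK4NegPhantomFrameTraceBit
import HarnessLib

/-!
# Route `GenusKolyvaginAtTwo`, crux K₄⁻ `K4Neg` (stmt-BirchSwinnertonDyer-31526), LINE 34 phantom cell F4ᵖᵍ —
# THE (β)-FRAMES IN KERNEL FORM: a prime Heegner twin is ENTANGLED ⟺ `ξ_W ∈ Sel₂(W)` ∧ `4 ∣ a_{ℓ₀}(W)`

Width seat `bsd-line-gk2-p4` g34 (cell `bsd-f1-sign2`), WIDTH-5 attach on route `GenusKolyvaginAtTwo` rev 59; sequel of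
`…K4NegPhantomFrameTraceBit` (p789093, the TRACE BIT `[ξ, F·F] = 0 ⟺ loc_ℓ ξ = 0 ⟺ 4 ∣ a_ℓ`).
`--supports stmt-BirchSwinnertonDyer-31526 --as helper`.  THEOREMS ONLY (no definition, no named fact, no `sorry`); standard axioms.
**BSD is NOT proved by this file; `K4Neg` is NOT proved; no item is closed by it.**

WHAT.  gk2-p4 g10's ENTANGLEMENT CRITERION (`GenusKolyTwistingPrime.forall_torsionFixing_four_smul_eq_iff_exists_selmer`, §48 of the
twisting-prime series): at a prime Heegner frame `K = ℚ(√−ℓ₀)` (`d_K = −ℓ₀` odd, Heegner for `N_W`, `2` split), for a model `Wd` of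
`W^{(d_K)}` with `#Sel₂(Wd) = 2` and `P ∈ Wd(ℚ)` with a half `Q` no `E[2]`-translate of which is rational, the twin is ENTANGLED — every
`h ∈ Γ_{ℚ(E[4])}` fixes `Q`, i.e. `P` is halvable in `Wd(ℚ(E[4]))`, i.e. (K₄⁻ cell, `P = y_K/2^{M₀}` up to odd multiples) THE TWIN'S SELMER
GENERATOR IS THE PHANTOM, gk2-p3 g34's (β)-frames, where the LEAD's Heegner descent bit `hDesc` fails — iff some non-zero `y ∈ Sel₂(W)`
dies on `Γ_{ℚ(E[4])}` AND is strict at `ℓ₀`.  The trace bit names the strictness clause: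

* ★★★ `forall_torsionFixing_four_smul_eq_iff_selmer_dying_and_four_dvd` — with `ρ̄_{W,2}`, `ρ_{W,4}` onto and an arithmetic Frobenius
  `γ` at `ℓ₀` acting on `E[2]` as an involution `≠ 1`: **ENTANGLED ⟺ (∃ `y ∈ Sel₂(W)`, `y ≠ 0`, dying on `Γ_{ℚ(E[4])}`) ∧ `4 ∣ a_{ℓ₀}(W)`**;
  `…_of_smul_eq_complexConjugation` — the same with `γ` acting as a complex conjugation (`Δ < 0`), gk2-p3 g34's export currency.
* `exists_torsionFixing_four_smul_ne_of_not_four_dvd` — **(α): if `¬ 4 ∣ a_{ℓ₀}` (i.e. `a_{ℓ₀} ≡ 2 (mod 4)`), the twin is NOT entangled**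
  (some `h ∈ Γ_{ℚ(E[4])}` moves the half `Q`) — for EVERY `W`, Selmer-entangled or not: the bottom (`M = 1`) instance of `hDesc`.
* `forall_torsionFixing_four_smul_eq_of_selmer_dying_of_four_dvd` — **(β): if `ξ_W ∈ Sel₂(W)` (the 2-adic bit FALSE) and `4 ∣ a_{ℓ₀}`, the
  twin IS entangled** — the honest residual sub-cell of the LEAD road on F4ᵖᵍ, kernel-exact: «bit FALSE ∧ `4 ∣ a_{ℓ₀}(E)`».

READING (LINE 34 census; nothing closed).  With p789093 this closes the dictionary (β) ⟺ «twin entangled» ⟺ «`s_y = ξ_E`» ⟺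
«`loc_{ℓ₀} ξ_E = 0` ∧ bit FALSE» ⟺ «`4 ∣ a_{ℓ₀}(E)` ∧ bit FALSE» in the kernel, in the supply's own currency (§48).  BSD is NOT proved.

References: [MazurRubin2010] Def. 3.1, Lemma 2.10–2.11, Prop. 3.3; [LawsonWuthrich2016] §3, §7.1; [GrossLMS1991] §3 (3.3), §9 Prop. 9.1, 9.6;
[SilvermanAEC2009] Thm. V.2.3.1, Prop. VII.4.1.
-/

set_option linter.dupNamespace false -- `Summit.<P>.<Sub>` repeats `BirchSwinnertonDyer` (D-0017)
set_option autoImplicit false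

noncomputable section

open scoped Classical Pointwise

namespace Summit.BirchSwinnertonDyer.BirchSwinnertonDyer.Theorems.GenusExact.PhantomDescentBit.TraceBit

open WeierstrassCurve Field NumberField IsDedekindDomain
open Literature.NumberTheory.GaloisRepresentations Literature.NumberTheory.EllipticCurves
open Literature.NumberTheory
open Rat.HeightOneSpectrum (primesEquiv)
open Summit.BirchSwinnertonDyer.BirchSwinnertonDyer.Theorems.GenusKolyTwistingPrime

variable (W : WeierstrassCurve ℚ) [W.IsElliptic] [W.IsGloballyMinimal] {K : Type} [Field K] [NumberField K]

/-- ★★★ **ENTANGLED ⟺ SELMER-ENTANGLED ∧ `4 ∣ a_{ℓ₀}`.**  In the frame of the entanglement criterion (`W/ℚ` globally minimal, `Δ < 0`,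
`ρ̄_{W,2}` and `ρ_{W,4}` onto; `K` imaginary quadratic with odd `d_K = −ℓ₀`, `ℓ₀` prime, Heegner for `N_W`, `2` split; `Wd` an elliptic model of
`W^{(d_K)}` with `#Sel₂(Wd) = 2`; `P ∈ Wd(ℚ)` with a half `Q` having no `Γ_ℚ`-fixed `E[2]`-translate), let `γ` be an arithmetic Frobenius at a
prime above `ℓ₀` acting on `E[2]` as an involution `≠ 1`.  Then **every `h ∈ Γ_{ℚ(E[4])}` fixes `Q` iff (`Sel₂(W)` contains a non-zero class
dying on `Γ_{ℚ(E[4])}`) and `4 ∣ a_{ℓ₀}(W)`** — §48 with its strictness clause `y ∈ ker loc_{ℓ₀}` replaced by the trace bit (p789093 §4).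
[cite: MazurRubin2010, Def. 3.1, Prop. 3.3] [cite: LawsonWuthrich2016, §3] [cite: GrossLMS1991, §9 Prop. 9.6] [cite: SilvermanAEC2009, Thm. V.2.3.1] -/
theorem forall_torsionFixing_four_smul_eq_iff_selmer_dying_and_four_dvd
    (hsurj : W.HasSurjectiveModNGaloisRep 2) (hsurj4 : W.HasSurjectiveModNGaloisRep 4)
    (hΔ : W.Δ < 0) (hK : IsImaginaryQuadratic K) (hodd : Odd (discr K))
    (hH : SatisfiesHeegnerHypothesis (W.conductorNorm ℤ) K) (h2K : ((Ideal.span {(2 : ℤ)}).primesOver (𝓞 K)).ncard = 2)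
    {ℓ : ℕ} [Fact ℓ.Prime] (hd : discr K = -(ℓ : ℤ)) {Wd : WeierstrassCurve ℚ} [Wd.IsElliptic] {C : VariableChange ℚ}
    (hWd : C • W.quadraticTwist (discr K : ℚ) = Wd) (h2 : Nat.card (Wd.selmerGroup 2) = 2)
    (P : Wd.toAffine.Point) (Q : geomPoints Wd) (hQ : (2 : ℤ) • Q = toGeomPoints Wd P)
    (hP : ∀ T ∈ geomTorsion Wd (2 : ℤ), Q - T ∉ MulAction.fixedPoints (absoluteGaloisGroup ℚ) (geomPoints Wd))
    {v : HeightOneSpectrum (𝓞 ℚ)} (hℓv : (ℓ : 𝓞 ℚ) ∈ v.asIdeal) {𝔓₀ : Ideal (absIntegers (𝓞 ℚ) ℚ)}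
    (h𝔓₀ : 𝔓₀ ∈ v.primesAbove) {γ : absoluteGaloisGroup ℚ} (hγ : IsArithFrobAt (𝓞 ℚ) γ 𝔓₀)
    (hinv : ∀ T : geomTorsion W (2 : ℤ), γ • γ • T = T) (hγT : ∃ T : geomTorsion W (2 : ℤ), γ • T ≠ T) :
    (∀ h ∈ torsionFixing W (4 : ℤ), h • Q = Q) ↔
      (∃ y ∈ W.selmerGroup 2, y ≠ 0 ∧ ∀ h ∈ torsionFixing W (4 : ℤ), h1Eval W (2 : ℤ) y h = 0) ∧
        (4 : ℤ) ∣ W.frobeniusTrace ℓ := by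
  rw [forall_torsionFixing_four_smul_eq_iff_exists_selmer W hΔ hK hodd hH h2K hd hWd h2 P Q hQ hP]
  have hℓ : ℓ.Prime := Fact.out
  obtain ⟨hℓ2, hℓN, -⟩ := GenusKolyTwin.prime_discr_facts W hK hodd hH hℓ hd
  have hW : W.HasGoodReductionAt v := by
    by_contra h
    exact hℓN ((primesEquiv_eq hℓ hℓv) ▸ (W.dvd_conductorNorm_iff v).mpr h)
  constructor
  · rintro ⟨y, hyS, hy0, hyd, hys⟩
    refine ⟨⟨y, hyS, hy0, hyd⟩, ?_⟩
    rw [strictLocalKer_eq_torsionLocalKer] at hys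
    exact (mem_torsionLocalKer_padic_iff_four_dvd_frobeniusTrace W hsurj hsurj4 hy0 hyd hℓ2 hℓv hW h𝔓₀ hγ hinv hγT).mp hys
  · rintro ⟨⟨y, hyS, hy0, hyd⟩, h4⟩
    refine ⟨y, hyS, hy0, hyd, ?_⟩
    rw [strictLocalKer_eq_torsionLocalKer]
    exact (mem_torsionLocalKer_padic_iff_four_dvd_frobeniusTrace W hsurj hsurj4 hy0 hyd hℓ2 hℓv hW h𝔓₀ hγ hinv hγT).mpr h4

/-- ★★★ **The same in gk2-p3 g34's export currency**: `γ` acts on `E[2]` as a complex conjugation `c₀` (a transposition since `Δ < 0`) —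
the shape `Frob_{ℓ₀} = Frob_∞` on `ℚ(E[2])` of every prime Heegner frame produced by `PhantomDescentBit.exists_levelFour_phantom_twistingPrime`.
[cite: MazurRubin2010, Prop. 3.3] [cite: LawsonWuthrich2016, §3] -/
theorem forall_torsionFixing_four_smul_eq_iff_selmer_dying_and_four_dvd_of_smul_eq_complexConjugation
    (hsurj : W.HasSurjectiveModNGaloisRep 2) (hsurj4 : W.HasSurjectiveModNGaloisRep 4)
    (hΔ : W.Δ < 0) (hK : IsImaginaryQuadratic K) (hodd : Odd (discr K))
    (hH : SatisfiesHeegnerHypothesis (W.conductorNorm ℤ) K) (h2K : ((Ideal.span {(2 : ℤ)}).primesOver (𝓞 K)).ncard = 2)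
    {ℓ : ℕ} [Fact ℓ.Prime] (hd : discr K = -(ℓ : ℤ)) {Wd : WeierstrassCurve ℚ} [Wd.IsElliptic] {C : VariableChange ℚ}
    (hWd : C • W.quadraticTwist (discr K : ℚ) = Wd) (h2 : Nat.card (Wd.selmerGroup 2) = 2)
    (P : Wd.toAffine.Point) (Q : geomPoints Wd) (hQ : (2 : ℤ) • Q = toGeomPoints Wd P)
    (hP : ∀ T ∈ geomTorsion Wd (2 : ℤ), Q - T ∉ MulAction.fixedPoints (absoluteGaloisGroup ℚ) (geomPoints Wd))
    {c₀ : absoluteGaloisGroup ℚ} (hc₀ : IsComplexConjugation (Rat.castHom ℝ) c₀)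
    {v : HeightOneSpectrum (𝓞 ℚ)} (hℓv : (ℓ : 𝓞 ℚ) ∈ v.asIdeal) {𝔓₀ : Ideal (absIntegers (𝓞 ℚ) ℚ)}
    (h𝔓₀ : 𝔓₀ ∈ v.primesAbove) {γ : absoluteGaloisGroup ℚ} (hγ : IsArithFrobAt (𝓞 ℚ) γ 𝔓₀)
    (hγc : ∀ T : geomTorsion W (2 : ℤ), γ • T = c₀ • T) :
    (∀ h ∈ torsionFixing W (4 : ℤ), h • Q = Q) ↔
      (∃ y ∈ W.selmerGroup 2, y ≠ 0 ∧ ∀ h ∈ torsionFixing W (4 : ℤ), h1Eval W (2 : ℤ) y h = 0) ∧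
        (4 : ℤ) ∣ W.frobeniusTrace ℓ := by
  have hsq : c₀ * c₀ = 1 := by have h := hc₀.sq_eq_one; rwa [sq] at h
  have hinv : ∀ T : geomTorsion W (2 : ℤ), γ • γ • T = T := fun T ↦ by
    rw [hγc, hγc, ← mul_smul, hsq, one_smul]
  have hγT : ∃ T : geomTorsion W (2 : ℤ), γ • T ≠ T := by
    obtain ⟨T, hT⟩ := KolyvaginEigenTwo.exists_twoTorsion_smul_ne_of_Δ_neg W hΔ hc₀
    exact ⟨T, fun h ↦ hT (by rw [← hγc, h])⟩
  exact forall_torsionFixing_four_smul_eq_iff_selmer_dying_and_four_dvd W hsurj hsurj4 hΔ hK hodd hH h2K hd hWd h2 P Q hQ hP hℓv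
    h𝔓₀ hγ hinv hγT

/-- **(α): at a frame with `a_{ℓ₀} ≢ 0 (mod 4)` NO prime Heegner twin is entangled** — some `h ∈ Γ_{ℚ(E[4])}` moves the half `Q` of the
twin's point `P`, for EVERY `W` (Selmer-entangled or not): the twin's generator is NOT halvable over `ℚ(E[4])`, i.e. its Kummer class is not
the phantom — the level-`4` content of the LEAD's descent bit `hDesc` at gk2-p3 g34's (α)-frames, in twin currency.
[cite: MazurRubin2010, Def. 3.1, Prop. 3.3] [cite: LawsonWuthrich2016, §3] -/
theorem exists_torsionFixing_four_smul_ne_of_not_four_dvd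
    (hsurj : W.HasSurjectiveModNGaloisRep 2) (hsurj4 : W.HasSurjectiveModNGaloisRep 4)
    (hΔ : W.Δ < 0) (hK : IsImaginaryQuadratic K) (hodd : Odd (discr K))
    (hH : SatisfiesHeegnerHypothesis (W.conductorNorm ℤ) K) (h2K : ((Ideal.span {(2 : ℤ)}).primesOver (𝓞 K)).ncard = 2)
    {ℓ : ℕ} [Fact ℓ.Prime] (hd : discr K = -(ℓ : ℤ)) {Wd : WeierstrassCurve ℚ} [Wd.IsElliptic] {C : VariableChange ℚ}
    (hWd : C • W.quadraticTwist (discr K : ℚ) = Wd) (h2 : Nat.card (Wd.selmerGroup 2) = 2)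
    (P : Wd.toAffine.Point) (Q : geomPoints Wd) (hQ : (2 : ℤ) • Q = toGeomPoints Wd P)
    (hP : ∀ T ∈ geomTorsion Wd (2 : ℤ), Q - T ∉ MulAction.fixedPoints (absoluteGaloisGroup ℚ) (geomPoints Wd))
    {v : HeightOneSpectrum (𝓞 ℚ)} (hℓv : (ℓ : 𝓞 ℚ) ∈ v.asIdeal) {𝔓₀ : Ideal (absIntegers (𝓞 ℚ) ℚ)}
    (h𝔓₀ : 𝔓₀ ∈ v.primesAbove) {γ : absoluteGaloisGroup ℚ} (hγ : IsArithFrobAt (𝓞 ℚ) γ 𝔓₀)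
    (hinv : ∀ T : geomTorsion W (2 : ℤ), γ • γ • T = T) (hγT : ∃ T : geomTorsion W (2 : ℤ), γ • T ≠ T)
    (h4 : ¬ (4 : ℤ) ∣ W.frobeniusTrace ℓ) :
    ∃ h ∈ torsionFixing W (4 : ℤ), h • Q ≠ Q := by
  by_contra hcon
  push Not at hcon
  exact h4 ((forall_torsionFixing_four_smul_eq_iff_selmer_dying_and_four_dvd W hsurj hsurj4 hΔ hK hodd hH h2K hd hWd h2 P Q hQ hP
    hℓv h𝔓₀ hγ hinv hγT).mp hcon).2

/-- **(β): at a frame with `4 ∣ a_{ℓ₀}` every prime Heegner twin of a SELMER-ENTANGLED curve (`ξ_W ∈ Sel₂(W)`, the 2-adic bit FALSE) IS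
entangled** — `Γ_{ℚ(E[4])}` fixes the half `Q`: the twin's generator is halvable over `ℚ(E[4])`, its Kummer class IS the phantom, and the LEAD's
`hDesc` fails there as stated.  This is the residual sub-cell «bit FALSE ∧ `4 ∣ a_{ℓ₀}(E)`» of the LEAD road on F4ᵖᵍ, kernel-exact.
[cite: MazurRubin2010, Def. 3.1, Prop. 3.3] [cite: LawsonWuthrich2016, §3, §7.1] -/
theorem forall_torsionFixing_four_smul_eq_of_selmer_dying_of_four_dvd
    (hsurj : W.HasSurjectiveModNGaloisRep 2) (hsurj4 : W.HasSurjectiveModNGaloisRep 4)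
    (hΔ : W.Δ < 0) (hK : IsImaginaryQuadratic K) (hodd : Odd (discr K))
    (hH : SatisfiesHeegnerHypothesis (W.conductorNorm ℤ) K) (h2K : ((Ideal.span {(2 : ℤ)}).primesOver (𝓞 K)).ncard = 2)
    {ℓ : ℕ} [Fact ℓ.Prime] (hd : discr K = -(ℓ : ℤ)) {Wd : WeierstrassCurve ℚ} [Wd.IsElliptic] {C : VariableChange ℚ}
    (hWd : C • W.quadraticTwist (discr K : ℚ) = Wd) (h2 : Nat.card (Wd.selmerGroup 2) = 2)
    (P : Wd.toAffine.Point) (Q : geomPoints Wd) (hQ : (2 : ℤ) • Q = toGeomPoints Wd P)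
    (hP : ∀ T ∈ geomTorsion Wd (2 : ℤ), Q - T ∉ MulAction.fixedPoints (absoluteGaloisGroup ℚ) (geomPoints Wd))
    {v : HeightOneSpectrum (𝓞 ℚ)} (hℓv : (ℓ : 𝓞 ℚ) ∈ v.asIdeal) {𝔓₀ : Ideal (absIntegers (𝓞 ℚ) ℚ)}
    (h𝔓₀ : 𝔓₀ ∈ v.primesAbove) {γ : absoluteGaloisGroup ℚ} (hγ : IsArithFrobAt (𝓞 ℚ) γ 𝔓₀)
    (hinv : ∀ T : geomTorsion W (2 : ℤ), γ • γ • T = T) (hγT : ∃ T : geomTorsion W (2 : ℤ), γ • T ≠ T)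
    (hent : ∃ y ∈ W.selmerGroup 2, y ≠ 0 ∧ ∀ h ∈ torsionFixing W (4 : ℤ), h1Eval W (2 : ℤ) y h = 0)
    (h4 : (4 : ℤ) ∣ W.frobeniusTrace ℓ) :
    ∀ h ∈ torsionFixing W (4 : ℤ), h • Q = Q :=
  (forall_torsionFixing_four_smul_eq_iff_selmer_dying_and_four_dvd W hsurj hsurj4 hΔ hK hodd hH h2K hd hWd h2 P Q hQ hP hℓv h𝔓₀ hγ
    hinv hγT).mpr ⟨hent, h4⟩

end Summit.BirchSwinnertonDyer.BirchSwinnertonDyer.Theorems.GenusExact.PhantomDescentBit.TraceBit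

end
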